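import Mathlib.Analysis.Calculus.Deriv.Prod
import Mathlib.Analysis.Calculus.Deriv.Comp
import Mathlib.Analysis.Calculus.Deriv.Mul
import Mathlib.Analysis.Calculus.ContDiff.Deriv
import Mathlib.Analysis.Calculus.TangentCone.Real
import Mathlib.Analysis.InnerProductSpace.Calculus
import Literature.Analysis.FluidPDE.ClassicalSolutionGlue
import Literature.Analysis.FluidPDE.RapidDecayLemmas
import HarnessLib

/-!
# Extended Galilean covariance of classical Navier–Stokes solutions (accelerated frames)

Analysis/FluidPDE support file (all results proved). The incompressible Navier–Stokes system
`∂ₜu + (u·∇)u = νΔu − ∇p + f`, `div u = 0` is covariant under **time-dependent translations of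
space**: if `(u, p)` is a classical solution on the time set `S` and `ξ : ℝ → E` is a smooth path,
then in the frame `y = x − ξ(t)` the pair
`v(t, y) = u(t, y + ξ(t)) − ξ'(t)`, `q(t, y) = p(t, y + ξ(t)) + ⟪ξ''(t), y⟫ − g(t)`
(any smooth gauge `g`) is again a classical solution, with force `f(t, y + ξ(t))` and the same
viscosity (`IsClassicalNSSolutionOn.galileanBoost`). The frame acceleration `ξ''` is absorbed by
the uniform pressure gradient `⟪ξ'', y⟫`; for an inertial frame `ξ(t) = t V` this is the classical
Galilean invariance `u ↦ u(t, y + tV) − V`, `p ↦ p(t, y + tV)` (Majda–Bertozzi 2002, §1.2;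
`IsClassicalNSSolutionOn.galileanBoost_const`). The slab predicate uses one-sided time
derivatives within `S`, so `S` must be a set of unique differentiability (`UniqueDiffOn ℝ S`,
e.g. `Ico 0 T`: `IsClassicalNSSolutionOn.galileanBoost_Ico`); the tree already has the static
space translation (`spaceTranslate`), time translation (`comp_add_right`) and the parabolic
scaling (`stRescale`) of classical solutions, and the Galilean covariance of the drift-mild class
(`IsKNSSDriftMild.galileanCovariance_R3`), but not the (extended) Galilean covariance of the
classical slab predicate.

The calculus input is the chain rule for a jointly smooth field along a moving point,
`d/ds u(s, γ(s)) = ∂ₜu(t, γ(t)) + Du(t, γ(t))[γ'(t)]` within `S`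
(`IsSmoothSpaceTimeOn.hasDerivWithinAt_comp_curve`).

## References

* A. J. Majda, A. L. Bertozzi, *Vorticity and Incompressible Flow*, CUP 2002, §1.2 (symmetry
  groups of the Euler and Navier–Stokes equations: Galilean invariance). [MajdaBertozzi2002]
* The accelerated-frame ("extended Galilean") form `x ↦ x + ξ(t)`, `u ↦ u + ξ'`,
  `p ↦ p − ⟪ξ'', x⟫` is the classical time-dependent translation symmetry of the incompressible
  system (folklore; e.g. the Lie point symmetry group of the Navier–Stokes equations).
-/

noncomputable section

open Set Function InnerProductSpace
open scoped Laplacian ContDiff RealInnerProductSpace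

namespace Literature.Analysis.FluidPDE

/-! ### Jointly smooth fields along moving points -/

section Curve

variable {X : Type*} [NormedAddCommGroup X] [NormedSpace ℝ X]
variable {F : Type*} [NormedAddCommGroup F] [NormedSpace ℝ F]

/-- **Chain rule along a moving point.** For a field `w` jointly smooth on `S × X`, `t ∈ S` a point
of unique differentiability of `S`, and a path `γ` with derivative `γ'` within `S` at `t`, the
composite `s ↦ w s (γ s)` has derivative `∂ₜw(t, γ t) + D(w t)(γ t)[γ']` within `S` at `t`
(`∂ₜ` the one-sided `timeDerivWithin S`). This is the material-derivative computation behind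
every change to a moving frame. [folklore] -/
theorem IsSmoothSpaceTimeOn.hasDerivWithinAt_comp_curve {S : Set ℝ} {w : ℝ → X → F}
    (h : IsSmoothSpaceTimeOn S w) {t : ℝ} (ht : t ∈ S) (hS : UniqueDiffWithinAt ℝ S t)
    {γ : ℝ → X} {γ' : X} (hγ : HasDerivWithinAt γ γ' S t) :
    HasDerivWithinAt (fun s => w s (γ s))
      (FluidPDE.timeDerivWithin S w t (γ t) + fderiv ℝ (w t) (γ t) γ') S t := by
  set L := fderivWithin ℝ (uncurry w) (S ×ˢ univ) (t, γ t) with hL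
  have h1 := h.hasFDerivWithinAt ht (γ t)
  have h2 : HasDerivWithinAt (fun s : ℝ => ((s, γ s) : ℝ × X)) ((1 : ℝ), γ') S t :=
    (hasDerivWithinAt_id t S).prodMk hγ
  have h3 : HasDerivWithinAt (uncurry w ∘ fun s => (s, γ s)) (L ((1 : ℝ), γ')) S t :=
    h1.comp_hasDerivWithinAt t h2 (fun s hs => mk_mem_prod hs (mem_univ _))
  have htime : FluidPDE.timeDerivWithin S w t (γ t) = L ((1 : ℝ), (0 : X)) := by
    rw [timeDerivWithin_apply]
    exact (h.hasDerivWithinAt_time ht (γ t)).derivWithin hS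
  have hspace : fderiv ℝ (w t) (γ t) γ' = L ((0 : ℝ), γ') := by
    rw [(h.hasFDerivAt_slice ht (γ t)).fderiv]
    simp [hL]
  have hsum : FluidPDE.timeDerivWithin S w t (γ t) + fderiv ℝ (w t) (γ t) γ' = L ((1 : ℝ), γ') := by
    rw [htime, hspace, ← map_add, Prod.mk_add_mk, add_zero, zero_add]
  rw [hsum]
  exact h3

/-- Joint smoothness is preserved by a smooth time-dependent translation of space:
`(t, y) ↦ w(t, y + ξ(t))` is jointly smooth on `S × X` for smooth `ξ`. [folklore] -/
theorem IsSmoothSpaceTimeOn.comp_add_curve {S : Set ℝ} {w : ℝ → X → F}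
    (h : IsSmoothSpaceTimeOn S w) {ξ : ℝ → X} (hξ : ContDiff ℝ ∞ ξ) :
    IsSmoothSpaceTimeOn S (fun t y => w t (y + ξ t)) := by
  have hΨ : ContDiff ℝ ∞ (fun z : ℝ × X => ((z.1, z.2 + ξ z.1) : ℝ × X)) :=
    contDiff_fst.prodMk (contDiff_snd.add (hξ.comp contDiff_fst))
  have hmaps : MapsTo (fun z : ℝ × X => ((z.1, z.2 + ξ z.1) : ℝ × X)) (S ×ˢ (univ : Set X))
      (S ×ˢ univ) := fun z hz => mk_mem_prod hz.1 (mem_univ _)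
  have := h.comp hΨ.contDiffOn hmaps
  refine this.congr fun z _ => ?_
  obtain ⟨t, y⟩ := z
  rfl

/-- Joint smoothness is preserved by subtracting a smooth function of time alone. [folklore] -/
theorem IsSmoothSpaceTimeOn.sub_time {S : Set ℝ} {w : ℝ → X → F}
    (h : IsSmoothSpaceTimeOn S w) {a : ℝ → F} (ha : ContDiff ℝ ∞ a) :
    IsSmoothSpaceTimeOn S (fun t y => w t y - a t) := by
  have := ContDiffOn.sub h ((ha.comp contDiff_fst).contDiffOn (s := S ×ˢ (univ : Set X)))
  refine this.congr fun z _ => ?_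
  obtain ⟨t, y⟩ := z
  rfl

/-- A globally smooth function of `(t, y)` is jointly smooth on every `S × X`. [folklore] -/
theorem isSmoothSpaceTimeOn_of_contDiff {S : Set ℝ} {w : ℝ → X → F}
    (h : ContDiff ℝ ∞ (uncurry w)) : IsSmoothSpaceTimeOn S w :=
  h.contDiffOn

end Curve

/-! ### Pointwise operators under translation by a constant vector -/

section Translate

variable {E : Type*} [NormedAddCommGroup E] [InnerProductSpace ℝ E] [FiniteDimensional ℝ E]
variable {F : Type*} [NormedAddCommGroup F] [NormedSpace ℝ F]

/-- The Laplacian commutes with translations: `Δ(φ(· + a))(y) = (Δφ)(y + a)` (Mathlib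
`iteratedFDeriv_comp_add_right`). [folklore] -/
theorem laplacian_comp_add_right (φ : E → F) (a y : E) :
    (Δ (fun z => φ (z + a))) y = (Δ φ) (y + a) := by
  rw [InnerProductSpace.laplacian_eq_iteratedFDeriv_orthonormalBasis _ (stdOrthonormalBasis ℝ E),
    InnerProductSpace.laplacian_eq_iteratedFDeriv_orthonormalBasis _ (stdOrthonormalBasis ℝ E)]
  simp only [iteratedFDeriv_comp_add_right]

/-- The Laplacian of a translate minus a constant: `Δ(φ(· + a) − c)(y) = (Δφ)(y + a)` for `φ`
of class `C²`. [folklore] -/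
theorem laplacian_comp_add_right_sub_const {φ : E → F} (hφ : ContDiff ℝ 2 φ) (a : E) (c : F)
    (y : E) : (Δ (fun z => φ (z + a) - c)) y = (Δ φ) (y + a) := by
  have h1 : ContDiffAt ℝ 2 (fun z => φ (z + a)) y :=
    (hφ.comp (contDiff_id.add contDiff_const)).contDiffAt
  have h2 : ContDiffAt ℝ 2 (fun _ : E => c) y := contDiffAt_const
  have : (fun z => φ (z + a) - c) = (fun z => φ (z + a)) - fun _ => c := rfl
  rw [this, h1.laplacian_sub h2, InnerProductSpace.laplacian_const, Pi.zero_apply, sub_zero,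
    laplacian_comp_add_right]

omit [FiniteDimensional ℝ E] in
/-- The divergence of a translate minus a constant vector: `div(ψ(· + a) − c)(y) = (div ψ)(y + a)`
(no differentiability needed). [folklore] -/
theorem divergence_comp_add_right_sub_const (ψ : E → E) (a c y : E) :
    VectorCalculus.divergence (fun z => ψ (z + a) - c) y =
      VectorCalculus.divergence ψ (y + a) := by
  unfold VectorCalculus.divergence
  rw [fderiv_sub_const, fderiv_comp_add_right]

omit [FiniteDimensional ℝ E] in
/-- The space derivative of a translate minus a constant: `D(φ(· + a) − c)(y) = Dφ(y + a)`.
[folklore] -/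
theorem fderiv_comp_add_right_sub_const (φ : E → F) (a : E) (c : F) (y : E) :
    fderiv ℝ (fun z => φ (z + a) - c) y = fderiv ℝ φ (y + a) := by
  rw [fderiv_sub_const, fderiv_comp_add_right]

/-- The gradient of `y ↦ θ(y + a) + ⟪b, y⟫ − c` is `∇θ(y + a) + b` for differentiable `θ`: a
uniform pressure gradient `b` is generated by the linear potential `⟪b, y⟫`. [folklore] -/
theorem gradient_comp_add_right_add_inner_sub_const {θ : E → ℝ} (hθ : Differentiable ℝ θ)
    (a b : E) (c : ℝ) (y : E) :
    gradient (fun z => θ (z + a) + ⟪b, z⟫ - c) y = gradient θ (y + a) + b := by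
  have h1 : HasFDerivAt (fun z => θ (z + a)) (fderiv ℝ θ (y + a)) y := by
    have := ((hθ (y + a)).hasFDerivAt).comp y ((hasFDerivAt_id y).add_const a)
    simpa [Function.comp_def] using this
  have h2 : HasFDerivAt (fun z : E => ⟪b, z⟫) (toDual ℝ E b) y := by
    have : (fun z : E => ⟪b, z⟫) = toDual ℝ E b := by
      funext z; rfl
    rw [this]
    exact (toDual ℝ E b).hasFDerivAt
  have h3 : HasFDerivAt (fun z => θ (z + a) + ⟪b, z⟫ - c) (fderiv ℝ θ (y + a) + toDual ℝ E b) y :=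
    (h1.add h2).sub_const c
  unfold gradient
  rw [h3.fderiv, map_add, LinearIsometryEquiv.symm_apply_apply]

end Translate

/-! ### Extended Galilean covariance -/

section Classical

variable {E : Type*} [NormedAddCommGroup E] [InnerProductSpace ℝ E] [FiniteDimensional ℝ E]
variable {S : Set ℝ} {ν : ℝ} {f u : ℝ → E → E} {p : ℝ → E → ℝ}

omit [FiniteDimensional ℝ E] in
/-- The derivative of a smooth path is smooth (Mathlib `contDiff_infty_iff_deriv`). [folklore] -/
theorem contDiff_deriv_of_contDiff_infty {ξ : ℝ → E} (hξ : ContDiff ℝ ∞ ξ) :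
    ContDiff ℝ ∞ (deriv ξ) :=
  (contDiff_infty_iff_deriv.1 hξ).2

omit [FiniteDimensional ℝ E] in
/-- **One-sided time derivative in the moving frame.** For `u` jointly smooth on `S × E`, a smooth
path `ξ`, `t ∈ S` with `UniqueDiffWithinAt ℝ S t`, and `y ∈ E`:
`∂ₜ[u(·, · + ξ) − ξ'](t, y) = ∂ₜu(t, y + ξ t) + Du(t, y + ξ t)[ξ'(t)] − ξ''(t)` (all time
derivatives of the fields one-sided within `S`). [folklore] -/
theorem timeDerivWithin_galileanBoost {u : ℝ → E → E} (hu : IsSmoothSpaceTimeOn S u)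
    {ξ : ℝ → E} (hξ : ContDiff ℝ ∞ ξ) {t : ℝ} (ht : t ∈ S) (hS : UniqueDiffWithinAt ℝ S t)
    (y : E) :
    timeDerivWithin S (fun s z => u s (z + ξ s) - deriv ξ s) t y =
      timeDerivWithin S u t (y + ξ t) + fderiv ℝ (u t) (y + ξ t) (deriv ξ t) -
        deriv (deriv ξ) t := by
  have hξ' : ContDiff ℝ ∞ (deriv ξ) := contDiff_deriv_of_contDiff_infty hξ
  have hγ : HasDerivWithinAt (fun s => y + ξ s) (deriv ξ t) S t :=
    (((hξ.differentiable (by simp)) t).hasDerivAt.const_add y).hasDerivWithinAt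
  have h1 := hu.hasDerivWithinAt_comp_curve ht hS hγ
  have h2 : HasDerivWithinAt (fun s => deriv ξ s) (deriv (deriv ξ) t) S t :=
    ((hξ'.differentiable (by simp)) t).hasDerivAt.hasDerivWithinAt
  rw [timeDerivWithin_apply]
  exact (h1.sub h2).derivWithin hS

/-- **Extended Galilean covariance of classical Navier–Stokes solutions (accelerated frames).**
Let `(u, p)` be a classical solution with viscosity `ν` and force `f` on a time set `S` of unique
differentiability, and let `ξ : ℝ → E` (frame path) and `g : ℝ → ℝ` (pressure gauge) be smooth.
Then in the translated frame `y = x − ξ(t)` the pair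
`v(t, y) = u(t, y + ξ t) − ξ'(t)`, `q(t, y) = p(t, y + ξ t) + ⟪ξ''(t), y⟫ − g(t)`
is a classical solution with the same viscosity and force `f(t, y + ξ t)` on `S`: the frame
acceleration is balanced by the uniform pressure gradient `∇⟪ξ'', y⟫ = ξ''`, the transport terms
`Du[ξ']` from the time derivative and `−Du[ξ']` from the convective term cancel, and `Δ`, `div`
commute with translations. For `ξ(t) = tV` this is Galilean invariance (Majda–Bertozzi 2002,
§1.2). [folklore] -/
theorem IsClassicalNSSolutionOn.galileanBoost (h : IsClassicalNSSolutionOn S ν f u p)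
    (hS : UniqueDiffOn ℝ S) {ξ : ℝ → E} (hξ : ContDiff ℝ ∞ ξ) {g : ℝ → ℝ} (hg : ContDiff ℝ ∞ g) :
    IsClassicalNSSolutionOn S ν (fun t y => f t (y + ξ t)) (fun t y => u t (y + ξ t) - deriv ξ t)
      (fun t y => p t (y + ξ t) + ⟪deriv (deriv ξ) t, y⟫ - g t) where
  smooth_velocity :=
    (h.smooth_velocity.comp_add_curve hξ).sub_time (contDiff_deriv_of_contDiff_infty hξ)
  smooth_pressure := by
    have hξ'' : ContDiff ℝ ∞ (deriv (deriv ξ)) :=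
      contDiff_deriv_of_contDiff_infty (contDiff_deriv_of_contDiff_infty hξ)
    have hlin : IsSmoothSpaceTimeOn S (fun t (y : E) => ⟪deriv (deriv ξ) t, y⟫) :=
      isSmoothSpaceTimeOn_of_contDiff ((hξ''.comp contDiff_fst).inner ℝ contDiff_snd)
    exact ((h.smooth_pressure.comp_add_curve hξ).add hlin).sub_time hg
  momentum t ht y := by
    have hξ' : ContDiff ℝ ∞ (deriv ξ) := contDiff_deriv_of_contDiff_infty hξ
    set x : E := y + ξ t with hx
    have hmom := h.momentum t ht x
    have hu2 : ContDiff ℝ 2 (u t) := (h.contDiff_velocity ht).of_le (by norm_cast)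
    have hp1 : Differentiable ℝ (p t) := (h.contDiff_pressure ht).differentiable (by simp)
    -- time derivative in the moving frame
    have hT := timeDerivWithin_galileanBoost h.smooth_velocity hξ ht (hS t ht) y
    -- convective term
    have hC : convect ((fun s z => u s (z + ξ s) - deriv ξ s) t)
        ((fun s z => u s (z + ξ s) - deriv ξ s) t) y =
        fderiv ℝ (u t) x (u t x) - fderiv ℝ (u t) x (deriv ξ t) := by
      simp only [convect_apply]
      rw [fderiv_comp_add_right_sub_const, map_sub]
    -- Laplacian
    have hL : (Δ ((fun s z => u s (z + ξ s) - deriv ξ s) t)) y = (Δ (u t)) x :=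
      laplacian_comp_add_right_sub_const hu2 (ξ t) (deriv ξ t) y
    -- pressure gradient
    have hG : gradient ((fun s z => p s (z + ξ s) + ⟪deriv (deriv ξ) s, z⟫ - g s) t) y =
        gradient (p t) x + deriv (deriv ξ) t :=
      gradient_comp_add_right_add_inner_sub_const hp1 (ξ t) (deriv (deriv ξ) t) (g t) y
    rw [hT, hC, hL, hG]
    rw [convect_apply] at hmom
    have hA : timeDerivWithin S u t x =
        ν • (Δ (u t)) x - gradient (p t) x + f t x - fderiv ℝ (u t) x (u t x) :=
      eq_sub_of_add_eq hmom
    rw [hA]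
    abel
  divFree t ht y := by
    change VectorCalculus.divergence (fun z => u t (z + ξ t) - deriv ξ t) y = 0
    rw [divergence_comp_add_right_sub_const]
    exact h.divFree t ht (y + ξ t)

/-- **Extended Galilean covariance, unforced case**: the boosted pair of an unforced classical
solution is an unforced classical solution (the zero force is translation invariant). [folklore] -/
theorem IsClassicalNSSolutionOn.galileanBoost_zero {u : ℝ → E → E} {p : ℝ → E → ℝ}
    (h : IsClassicalNSSolutionOn S ν 0 u p) (hS : UniqueDiffOn ℝ S) {ξ : ℝ → E}
    (hξ : ContDiff ℝ ∞ ξ) {g : ℝ → ℝ} (hg : ContDiff ℝ ∞ g) :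
    IsClassicalNSSolutionOn S ν 0 (fun t y => u t (y + ξ t) - deriv ξ t)
      (fun t y => p t (y + ξ t) + ⟪deriv (deriv ξ) t, y⟫ - g t) :=
  h.galileanBoost hS hξ hg

/-- **Extended Galilean covariance on `[0, T)`** (the form used for classical solutions from
initial data; `Ico 0 T` is a set of unique differentiability, Mathlib `uniqueDiffOn_Ico`): for
every smooth frame path `ξ` and gauge `g`, `(u(t, y + ξ t) − ξ'(t), p(t, y + ξ t) + ⟪ξ''(t), y⟫ − g t)`
is an unforced classical solution on `[0, T)` whenever `(u, p)` is. [folklore] -/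
theorem IsClassicalNSSolutionOn.galileanBoost_Ico {T : ℝ} {u : ℝ → E → E} {p : ℝ → E → ℝ}
    (h : IsClassicalNSSolutionOn (Ico 0 T) ν 0 u p) {ξ : ℝ → E} (hξ : ContDiff ℝ ∞ ξ)
    {g : ℝ → ℝ} (hg : ContDiff ℝ ∞ g) :
    IsClassicalNSSolutionOn (Ico 0 T) ν 0 (fun t y => u t (y + ξ t) - deriv ξ t)
      (fun t y => p t (y + ξ t) + ⟪deriv (deriv ξ) t, y⟫ - g t) :=
  h.galileanBoost (uniqueDiffOn_Ico 0 T) hξ hg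

/-- **Galilean invariance** (inertial frames; Majda–Bertozzi 2002, §1.2): for a constant velocity
`V`, `(u(t, y + tV) − V, p(t, y + tV))` is a classical solution with force `f(t, y + tV)` on any
time set of unique differentiability whenever `(u, p)` is one with force `f` — the case
`ξ(t) = tV`, `g = 0` of `galileanBoost` (`ξ' = V`, `ξ'' = 0`). [cite: MajdaBertozzi2002, §1.2] -/
theorem IsClassicalNSSolutionOn.galileanBoost_const (h : IsClassicalNSSolutionOn S ν f u p)
    (hS : UniqueDiffOn ℝ S) (V : E) :
    IsClassicalNSSolutionOn S ν (fun t y => f t (y + t • V)) (fun t y => u t (y + t • V) - V)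
      (fun t y => p t (y + t • V)) := by
  have hξ : ContDiff ℝ ∞ (fun t : ℝ => t • V) := contDiff_id.smul contDiff_const
  have hd : deriv (fun t : ℝ => t • V) = fun _ => V := by
    funext t
    simpa using ((hasDerivAt_id t).smul_const V).deriv
  have key := h.galileanBoost hS hξ (g := fun _ => (0 : ℝ)) contDiff_const
  simp only [hd, deriv_const', inner_zero_left, add_zero, sub_zero] at key
  exact key

/-- **Galilean invariance, unforced case on `[0, T)`**: `(u(t, y + tV) − V, p(t, y + tV))` is an
unforced classical solution on `[0, T)` whenever `(u, p)` is (Majda–Bertozzi 2002, §1.2).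
[cite: MajdaBertozzi2002, §1.2] -/
theorem IsClassicalNSSolutionOn.galileanBoost_const_Ico {T : ℝ} {u : ℝ → E → E}
    {p : ℝ → E → ℝ} (h : IsClassicalNSSolutionOn (Ico 0 T) ν 0 u p) (V : E) :
    IsClassicalNSSolutionOn (Ico 0 T) ν 0 (fun t y => u t (y + t • V) - V)
      (fun t y => p t (y + t • V)) :=
  h.galileanBoost_const (uniqueDiffOn_Ico 0 T) V

end Classical

end Literature.Analysis.FluidPDE

end
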